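import Summits.BirchSwinnertonDyer.BirchSwinnertonDyer.Theorems.KolyvaginDepthDoorDepthTableSteinWuthrichRows9
import Summits.BirchSwinnertonDyer.BirchSwinnertonDyer.Theorems.KolyvaginDepthDoorKNSupplyLevelOneStructure
import Summits.BirchSwinnertonDyer.BirchSwinnertonDyer.Theorems.KolyvaginDepthDoorKNSupplyResidualStructureOfPrint
import Literature.NumberTheory.EllipticCurves.LeadingTermPPartRankLeOne
import Literature.NumberTheory.EllipticCurves.SelmerTorsionTwistRestriction
import Literature.NumberTheory.EllipticCurves.IrreducibleModPQuadraticTwistProofs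
import Literature.NumberTheory.EllipticCurves.ComplexMultiplication
import HarnessLib

/-!
# Route `KolyvaginDepthDoor`, crux `KolyvaginDepthSupplyKN` (stmt-BirchSwinnertonDyer-22820) —
# DEPTH TABLE v14, GENERIC: at ODD rank the depth door closes, per curve, on ONE `L`-VALUE VALUATION of the
# rank-zero Heegner twist (Stein–Wuthrich + W. Zhang + Skinner 2016 Thm. C + Gross–Zagier–Kolyvagin, BY NAME)

Helper file of the lead prover of line `levelone` (kdd-p1 g18; `--supports stmt-BirchSwinnertonDyer-22820
--as helper`); it closes nothing and BSD is NOT proved by it.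

The per-curve files `…RankThree<label>TwistLValue` (5077a1, 11197a1, 16811a1, 18097b1, 11642a1, 13766a1, 12279a1; 18745a1
at `p = 7`) all run the same chain; this file states it ONCE, for any curve, prime and twist model:

* `natCard_selmerGroup_eq_one_of_rankZero_LValue` — **Skinner 2016 Thm. C + GZK ⟹ trivial `p`-Selmer group.** `T/ℚ` globally
  minimal, `p ≥ 5` good ordinary (or multiplicative) for `T`, `T[p]` irreducible, a multiplicative prime `q ≠ p` with
  `p ∤ v_q(Δ_T)`, Kodaira–Néron at `p` (`p ∤ ord_v Δ_T` at multiplicative `v`, whence `p ∤ Tam(T)`), `L(T,1) ≠ 0` and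
  `ord_p(L(T,1)/Ω_T) ≤ 0` ⟹ `#Sel_p(T/ℚ) = 1` (`r_an = 0` ⟹ rank `0`, `Ш` finite; Skinner: `ord_p(L/Ω) = ord_p #Ш + ord_p Tam`;
  so `p ∤ #Ш`, `Ш[p] = 0`; exact descent count).
* `cruxBody_of_twistLValue_of_steinWuthrich_skinner` — **THE ODD-RANK ROW MECHANISM.** `W` in the Stein–Wuthrich range on
  W. Zhang's ♠ cell at an admissible Kodaira–Néron prime `p` (the hypotheses of g17's `cruxBody_of_twistSelmer_of_steinWuthrich`),
  `K` Heegner (`d_K ∉ {−3,−4}`, `p ∤ d_K`), and a globally minimal `T` with `C • T = W.quadraticTwist d_K` carrying the rank-zero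
  data above: THEN the CLAUSE of `KolyvaginDepthSupplyKN` holds at `W` verbatim. `T[p]` irreducible is DERIVED (twist-invariance
  from `ρ̄_{W,p}` onto); `#Sel_p` is transported along `C` (`natCard_selmerGroup_eq_of_variableChange`).

Only an odd-rank `W` can meet the hypotheses (`L(T,1) ≠ 0` forces the twist to have analytic rank `0`, i.e. even). CONDITIONAL
on the four named print facts; per `(W, p, K, T)`; nothing class-wide (the open stub (S♭) is untouched); BSD is NOT proved by it.

References: [Skinner2016PacificMC] Thm. C (p. 173); [Darmon2004] Thm. 3.22; [SteinWuthrich2013] Thm. 1.1; [WZhang2014]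
Lemma 8.4 (1), Thm. 9.1; [SilvermanAEC2009] X.4.2, X.5 Cor. 5.4, C.15.
-/

set_option linter.dupNamespace false

noncomputable section

open scoped Classical NumberField

namespace Summit.BirchSwinnertonDyer.BirchSwinnertonDyer.Theorems.KolyvaginDepthDoor

open Literature.NumberTheory.EllipticCurves Literature.NumberTheory.EllipticCurves.ModularForms
  WeierstrassCurve NumberField IsDedekindDomain
open Summit.BirchSwinnertonDyer.BirchSwinnertonDyer.Theorems

/-- An abelian group whose `Nat.card` is prime to `p` (so finite) has no `p`-torsion: `Ш ⊓ H¹[p] = ⊥` when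
`p ∤ #Ш` (the order of a `p`-torsion element divides `gcd(p, #Ш) = 1`). [folklore] -/
theorem sha_inf_torsionBy_eq_bot_of_not_dvd_natCard (V : WeierstrassCurve ℚ) [V.IsElliptic] (p : ℕ)
    (hp : p.Prime) (hnd : ¬ p ∣ Nat.card V.sha) :
    (V.sha ⊓ AddSubgroup.torsionBy V.galH1 (p : ℤ) : AddSubgroup V.galH1) = ⊥ := by
  rw [eq_bot_iff]
  intro c hc
  obtain ⟨hsha, htor⟩ := AddSubgroup.mem_inf.mp hc
  have hn : p • c = 0 := AddSubgroup.torsionBy.nsmul_iff.mp htor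
  set y : V.sha := ⟨c, hsha⟩ with hy
  have hy0 : p • y = 0 := Subtype.ext (by simpa [hy] using hn)
  have h1 : addOrderOf y ∣ p := addOrderOf_dvd_of_nsmul_eq_zero hy0
  have h2 : addOrderOf y ∣ Nat.card V.sha := addOrderOf_dvd_natCard y
  have hcop : Nat.Coprime p (Nat.card V.sha) := (Nat.Prime.coprime_iff_not_dvd hp).mpr hnd
  have hone : addOrderOf y = 1 := by
    have h := Nat.dvd_gcd h1 h2
    rw [Nat.Coprime.gcd_eq_one hcop] at h
    exact Nat.dvd_one.mp h
  have hy' : y = 0 := AddMonoid.addOrderOf_eq_one_iff.mp hone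
  rw [AddSubgroup.mem_bot]
  simpa [hy] using congrArg Subtype.val hy'

/-- **Skinner 2016 Thm. C + Gross–Zagier–Kolyvagin ⟹ a trivial `p`-Selmer group from ONE `L`-value valuation** (generic,
rank-zero). `T/ℚ` globally minimal; `p ≥ 5` of good ordinary or multiplicative reduction for `T`; `T[p]` irreducible; a
multiplicative prime `q ≠ p` with `p ∤ v_q(Δ_T)`; Kodaira–Néron at `p` (so `p ∤ Tam(T)`: additive fibres have `c_v ≤ 4 < p`);
`L(T,1) ≠ 0`; and the algebraic part `L(T,1)/Ω_T ∈ ℚ` has `ord_p ≤ 0`. THEN `#Sel_p(T/ℚ) = 1`: `r_an(T) = 0`, so (GZK) `rank T = 0`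
and `Ш(T)` finite; Skinner's `ord_p(L(T,1)/Ω_T) = ord_p #Ш(T) + ord_p Tam(T)`; hence `p ∤ #Ш(T)`, `Ш(T)[p] = 0`, and the exact
descent count `#Sel_p = p^{rank}` (`T(ℚ)[p] = 0`). CONDITIONAL on the two named facts; BSD is not proved by it.
[cite: Skinner2016PacificMC, Thm. C (p. 173)] [cite: Darmon2004, Thm. 3.22] [cite: SilvermanAEC2009, Thm. X.4.2, C.15 Table 15.1] -/
theorem natCard_selmerGroup_eq_one_of_rankZero_LValue
    (hSk : Skinner2016_padicValRat_bsd_rank_zero) (hGZK : rank_eq_analyticRank_of_analyticRank_le_one)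
    (T : WeierstrassCurve ℚ) [T.IsElliptic] [T.IsGloballyMinimal] (p : ℕ) [hp : Fact p.Prime] (h5 : 5 ≤ p)
    (hred : (T.HasGoodReductionAtPrime p ∧ ¬ (p : ℤ) ∣ T.frobeniusTrace p) ∨ T.HasMultiplicativeReductionAtPrime p)
    (hirr : T.HasIrreducibleModPGaloisRep p)
    (hram : ∃ q : ℕ, ∃ _ : Fact q.Prime, q ≠ p ∧ T.HasMultiplicativeReductionAtPrime q ∧
      ¬ p ∣ padicValInt q T.minimalDiscriminantInt)
    (hKN : ∀ v : HeightOneSpectrum (𝓞 ℚ), T.HasMultiplicativeReductionAt v → ¬ p ∣ T.ordMinimalDiscriminant v)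
    (hL : T.entireLFunction 1 ≠ 0)
    (hval : ∀ q : ℚ, T.entireLFunction 1 / ((T.realPeriodRat : ℝ) : ℂ) = (q : ℂ) → padicValRat p q ≤ 0) :
    Nat.card (T.selmerGroup p) = 1 := by
  have hpP : p.Prime := hp.out
  have h0 : T.analyticRank = 0 := analyticRank_eq_zero_of_entireLFunction_one_ne_zero T hL
  obtain ⟨hrank, hfin⟩ := hGZK T (by rw [h0]; norm_num)
  rw [h0] at hrank
  obtain ⟨q, hq, hv⟩ := hSk T p (le_trans (by norm_num) h5) hred hirr hram hL hfin
  have hv0 : padicValRat p q ≤ 0 := hval q hq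
  have htam : ¬ p ∣ T.tamagawaProduct := not_dvd_tamagawaProduct_of_kodairaNeron T p h5 hKN
  have htam0 : padicValNat p T.tamagawaProduct = 0 := padicValNat.eq_zero_of_not_dvd htam
  have hle : ((padicValNat p T.shaOrder : ℕ) : ℤ) + ((padicValNat p T.tamagawaProduct : ℕ) : ℤ) ≤ 0 := by
    rw [← hv]; exact hv0
  have hsha0 : padicValNat p T.shaOrder = 0 := by omega
  haveI : Finite T.sha := hfin
  have hpos : T.shaOrder ≠ 0 := by
    rw [WeierstrassCurve.shaOrder]; exact Nat.card_pos.ne'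
  have hnd : ¬ p ∣ T.shaOrder := by
    rcases padicValNat.eq_zero_iff.mp hsha0 with h | h | h
    · exact absurd h hpP.one_lt.ne'
    · exact absurd h hpos
    · exact h
  have hshaT : (T.sha ⊓ AddSubgroup.torsionBy T.galH1 (p : ℤ) : AddSubgroup T.galH1) = ⊥ :=
    sha_inf_torsionBy_eq_bot_of_not_dvd_natCard T p hpP (by rwa [WeierstrassCurve.shaOrder] at hnd)
  rw [natCard_selmerGroup_eq_pow_rank_of_sha_inf_torsionBy_eq_bot T p hirr hshaT, hrank, pow_zero]

/-- **THE ODD-RANK ROW MECHANISM (generic): the clause of `KolyvaginDepthSupplyKN` at a Stein–Wuthrich ♠-cell curve from ONE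
`L`-VALUE VALUATION of its rank-zero Heegner twist.** `W` globally minimal, non-CM, `2 ≤ rank`, `N_E ≤ 30 000`; `5 ≤ p < 1000`
good ordinary, `ρ_{W,p^n}` onto for all `n`, Kodaira–Néron, ♠ (1), ♠ (2); `K` imaginary quadratic Heegner for `N_E`,
`d_K ∉ {−3,−4}`, `p ∤ d_K`; `T` a globally minimal model of the twist, `C • T = W.quadraticTwist d_K`, with: good ordinary (or
multiplicative) `p`, a multiplicative `q ≠ p` with `p ∤ v_q(Δ_T)`, Kodaira–Néron at `p`, `L(T,1) ≠ 0`, `ord_p(L(T,1)/Ω_T) ≤ 0`.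
THEN the crux's clause holds at `W` verbatim: `T[p]` is irreducible (twist-invariance from `ρ̄_{W,p}` onto,
`hasIrreducibleModPGaloisRep_iff_of_smul_eq_quadraticTwist`), `#Sel_p(T) = 1` (`natCard_selmerGroup_eq_one_of_rankZero_LValue`),
transport along `C` (`natCard_selmerGroup_eq_of_variableChange`), and g17's `cruxBody_of_twistSelmer_of_steinWuthrich`
(`1 ≤ p^rank`). Since `L(T,1) ≠ 0` makes the twist's analytic rank even (zero), only ODD-rank `W` qualify. CONDITIONAL on
Stein–Wuthrich 2013 Thm. 1.1, W. Zhang 2014 L8.4 (1) / 9.1, Skinner 2016 Thm. C and GZK by name; per `(W, p, K, T)`; BSD is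
not proved by it. [cite: SteinWuthrich2013, Thm. 1.1 (p. 1758)] [cite: WZhang2014, Lemma 8.4 (1) (p. 236), Thm. 9.1 (p. 240)]
[cite: Skinner2016PacificMC, Thm. C (p. 173)] [cite: Darmon2004, Thm. 3.22] [cite: SilvermanAEC2009, X.5 Cor. 5.4] -/
theorem cruxBody_of_twistLValue_of_steinWuthrich_skinner
    (hSW : SteinWuthrich2013_sha_inf_torsionBy_eq_bot_of_two_le_rank)
    (h84 : Literature.NumberTheory.EllipticCurves.WZhang2014_lemma84_exists_minimal_kolyvaginClass_one_selmerCard)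
    (hSk : Skinner2016_padicValRat_bsd_rank_zero) (hGZK : rank_eq_analyticRank_of_analyticRank_le_one)
    (W : WeierstrassCurve ℚ) [W.IsElliptic] [W.IsGloballyMinimal] (hcm : ¬ W.HasCM) (hr : 2 ≤ W.mordellWeilRank)
    (hN : W.conductorNorm ℤ ≤ 30000)
    (p : ℕ) [hp : Fact p.Prime] (h5 : 5 ≤ p) (hp1000 : p < 1000) (hgood : W.HasGoodReductionAtPrime p)
    (hord : ¬ (p : ℤ) ∣ W.frobeniusTrace p)
    (htower : ∀ n : ℕ, W.HasSurjectiveModNGaloisRep (p ^ n : ℕ))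
    (hKN : ∀ v : HeightOneSpectrum (𝓞 ℚ), W.HasMultiplicativeReductionAt v →
      ¬ p ∣ W.ordMinimalDiscriminant v)
    (hS1 : ∀ (ℓ : ℕ) [Fact ℓ.Prime], W.HasMultiplicativeReductionAtPrime ℓ →
      ¬ p ∣ padicValInt ℓ W.minimalDiscriminantInt)
    (hS2 : ¬ Squarefree (W.conductorNorm ℤ) →
      (∃ (ℓ : ℕ) (_ : Fact ℓ.Prime), W.HasMultiplicativeReductionAtPrime ℓ ∧
          ¬ p ∣ padicValInt ℓ W.minimalDiscriminantInt) ∧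
        ∃ (ℓ₁ ℓ₂ : ℕ) (_ : Fact ℓ₁.Prime) (_ : Fact ℓ₂.Prime), ℓ₁ ≠ ℓ₂ ∧
          W.HasMultiplicativeReductionAtPrime ℓ₁ ∧ W.HasMultiplicativeReductionAtPrime ℓ₂)
    (K : Type) [Field K] [NumberField K] (hK : IsImaginaryQuadratic K)
    (hD3 : NumberField.discr K ≠ -3) (hD4 : NumberField.discr K ≠ -4)
    (hpD : ¬ ((p : ℤ) ∣ NumberField.discr K))
    [iNZ : NeZero (W.conductorNorm ℤ)] (hH : SatisfiesHeegnerHypothesis (W.conductorNorm ℤ) K)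
    (T : WeierstrassCurve ℚ) [T.IsElliptic] [T.IsGloballyMinimal] (C : WeierstrassCurve.VariableChange ℚ)
    (hC : C • T = W.quadraticTwist (NumberField.discr K : ℚ))
    (hTred : (T.HasGoodReductionAtPrime p ∧ ¬ (p : ℤ) ∣ T.frobeniusTrace p) ∨ T.HasMultiplicativeReductionAtPrime p)
    (hTram : ∃ q : ℕ, ∃ _ : Fact q.Prime, q ≠ p ∧ T.HasMultiplicativeReductionAtPrime q ∧
      ¬ p ∣ padicValInt q T.minimalDiscriminantInt)
    (hTKN : ∀ v : HeightOneSpectrum (𝓞 ℚ), T.HasMultiplicativeReductionAt v → ¬ p ∣ T.ordMinimalDiscriminant v)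
    (hL : T.entireLFunction 1 ≠ 0)
    (hval : ∀ q : ℚ, T.entireLFunction 1 / ((T.realPeriodRat : ℝ) : ℂ) = (q : ℂ) → padicValRat p q ≤ 0) :
    ∃ (p : ℕ) (hp : Fact p.Prime), 5 ≤ p ∧ W.HasGoodReductionAtPrime p ∧
      ¬ (p : ℤ) ∣ W.frobeniusTrace p ∧ (∀ n : ℕ, W.HasSurjectiveModNGaloisRep (p ^ n : ℕ)) ∧
      (∀ v : HeightOneSpectrum (𝓞 ℚ), W.HasMultiplicativeReductionAt v →
        ¬ p ∣ W.ordMinimalDiscriminant v) ∧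
      ∃ (K : Type) (_ : Field K) (_ : NumberField K), IsImaginaryQuadratic K ∧
        NumberField.discr K ≠ -3 ∧ NumberField.discr K ≠ -4 ∧
        ∃ (_ : NeZero (W.conductorNorm ℤ)), SatisfiesHeegnerHypothesis (W.conductorNorm ℤ) K ∧
        ∃ (Dt : ModularParametrizationData W (W.conductorNorm ℤ)) (β : ℤ) (ι : K →+* ℂ) (n₁ : ℕ)
          (d : KolyvaginHeegnerData Dt β ι n₁), Squarefree n₁ ∧
          (∀ q ∈ n₁.primeFactors, Zhang2014.IsKolyvaginPrime (W.conductorNorm ℤ) W K p q) ∧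
          d.kolyvaginClass hp.out 1 ≠ 0 ∧
          (n₁.primeFactors.card + 1 ≤ W.mordellWeilRank ∨
            (n₁.primeFactors.card ≤ W.mordellWeilRank ∧
              n₁.primeFactors.card + 1 ≤ (W.quadraticTwist (NumberField.discr K : ℚ)).mordellWeilRank)) := by
  have hdK : (NumberField.discr K : ℚ) ≠ 0 := by exact_mod_cast NumberField.discr_ne_zero K
  have hsur : W.HasSurjectiveModNGaloisRep p := by simpa only [pow_one] using htower 1
  have hirrW : W.HasIrreducibleModPGaloisRep p := hasIrreducibleModPGaloisRep_of_hasSurjectiveModNGaloisRep W p hsur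
  have hirrT : T.HasIrreducibleModPGaloisRep p :=
    (W.hasIrreducibleModPGaloisRep_iff_of_smul_eq_quadraticTwist T hdK hC p).mpr hirrW
  have hSelT : Nat.card (T.selmerGroup p) = 1 :=
    natCard_selmerGroup_eq_one_of_rankZero_LValue hSk hGZK T p h5 hTred hirrT hTram hTKN hL hval
  have hSel : Nat.card ((W.quadraticTwist (NumberField.discr K : ℚ)).selmerGroup p) = 1 := by
    rw [← natCard_selmerGroup_eq_of_variableChange (p : ℤ) hC]; exact hSelT
  exact cruxBody_of_twistSelmer_of_steinWuthrich hSW h84 W hcm hr hN p h5 hp1000 hgood hord htower hKN hS1 hS2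
    K hK hD3 hD4 hpD hH (by rw [hSel]; exact Nat.one_le_pow _ _ hp.out.pos)

end Summit.BirchSwinnertonDyer.BirchSwinnertonDyer.Theorems.KolyvaginDepthDoor

end
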